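import Summits.CriticalPhenomena.PercolationContinuityZ3.Theorems.PercNearOneGluingNoHeavyLowerTailSahiLatinKernel4
import Summits.CriticalPhenomena.PercolationContinuityZ3.Theorems.PercNearOneGluingNoHeavyLowerTailSahiLatinFunctionals
import Summits.CriticalPhenomena.PercolationContinuityZ3.Theorems.PercNearOneGluingNoHeavyLowerTailSahiLatinDescent

/-!
# `NoHeavyLowerTail` (crux stmt-CriticalPhenomena-4575), Sahi programme (prim-master-conj gen 42): the ORDER-4 MOVE LEMMAS R₄ and A₄
# in EVERY dimension — the order-4 charge is signed by the Venn cell of the point, GIVEN order-3 positivity FBP(3,d) on the link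

Support file (`--supports stmt-CriticalPhenomena-4575`; companion of `…SahiLatinKernel4`, `…SahiLatinFunctionals`).  Memo
`run/shared/lean/prim/prim-l12/FROM-prim-master-conj-g41-DESCENT.md` §10 (MOVE IDENTITY, Lemmas A₄/R₄; here formalised).

With `β,γ,δ = [u∈b],[u∈c],[u∈d]`, the traces `b',c',d' ⊆ [3]^ι` of `b,c,d` on the link of `u` (`SahiLatin.pull4`) and the Latin
functionals `S1`, `latinPairs`, `latinTriples`, `L = Lnum ι` of `[3]^ι`:
* `Phi4_eq_functionals` — the MOVE IDENTITY `Φ⁴_{bcd}(u) = 6βγδ·L − 2(βγ S(d') + βδ S(c') + γδ S(b') + S(b'c'd')) − (β S(c'd') + γ S(b'd')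
  + δ S(b'c')) + (β E2(c',d') + γ E2(b',d') + δ E2(b',c') + E2(b'c',d') + E2(b'd',c') + E2(c'd',b')) − E3(b',c',d')`;
* `Phi4_eq_kappa` — the same regrouped: **`Φ⁴ = 6βγδ·L − κ₃(b',c',d') − β[S(c'd') − E2(c',d')] − γ[…] − δ[…] − 2(βγ S(d') + βδ S(c') + γδ S(b'))`**
  (the cell-`0` move is exactly `−κ₃` of the link traces);
* **LEMMA A₄** (`Phi4_nonpos`): if FBP(3,|ι|) holds (`LatinPos ι`), `b,c,d` are up-sets and `u ∉ b ∩ c ∩ d`, then `Φ⁴_{bcd}(u) ≤ 0`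
  (`κ₃ ≥ 0` on the pulled-back traces + T1 `E2(s,t) ≤ S(s∩t)` + `S ≥ 0`);
* **LEMMA R₄** (`Phi4_nonneg`; no hypotheses on the sets): if `u ∈ b ∩ c ∩ d` then `Φ⁴ ≥ 2(L − S(b'c'd')) + E₁ ≥ 0` (Bonferroni ×3 and
  the empty-corner functional);
* the signed single-point moves of `K₄` in all four slots (`kappa4_erase_le…`, `kappa4_insert_le…`) and up-set bookkeeping on `[4]^ι`.
Everything here is proved; axioms standard.
-/

namespace Summit.CriticalPhenomena.PercolationContinuityZ3.Theorems.SahiLatin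

open Finset

variable {ι : Type*} [Fintype ι] [DecidableEq ι]

/-! ## The move identity -/

/-- **MOVE IDENTITY**: the order-4 charge through the Latin functionals of the link traces. [this work] -/
theorem Phi4_eq_functionals (b c d : Finset (Pt4 ι)) (u : Pt4 ι) :
    Phi4 b c d u =
      6 * (ind b u * ind c u * ind d u) * Lnum ι
      - 2 * (ind b u * ind c u * S1 (pull4 u d) + ind b u * ind d u * S1 (pull4 u c) + ind c u * ind d u * S1 (pull4 u b)
          + S1 (pull4 u b ∩ pull4 u c ∩ pull4 u d))
      - (ind b u * S1 (pull4 u c ∩ pull4 u d) + ind c u * S1 (pull4 u b ∩ pull4 u d) + ind d u * S1 (pull4 u b ∩ pull4 u c))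
      + (ind b u * latinPairs (pull4 u c) (pull4 u d) + ind c u * latinPairs (pull4 u b) (pull4 u d)
          + ind d u * latinPairs (pull4 u b) (pull4 u c) + latinPairs (pull4 u b ∩ pull4 u c) (pull4 u d)
          + latinPairs (pull4 u b ∩ pull4 u d) (pull4 u c) + latinPairs (pull4 u c ∩ pull4 u d) (pull4 u b))
      - latinTriples (pull4 u b) (pull4 u c) (pull4 u d) := by
  have hL : (6 * (ind b u * ind c u * ind d u) * Lnum ι : ℤ) = ∑ _σ : LPerm ι, 6 * (ind b u * ind c u * ind d u) := by
    simp [Lnum]; ring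
  rw [hL]
  unfold Phi4 S1 latinPairs latinTriples
  simp only [H4, ind_emb, ind_inter, mul_sum, ← sum_sub_distrib, ← sum_add_distrib]
  exact sum_congr rfl fun σ _ => by ring

/-- **The move identity regrouped around `κ₃` of the link traces.** [this work] -/
theorem Phi4_eq_kappa (b c d : Finset (Pt4 ι)) (u : Pt4 ι) :
    Phi4 b c d u =
      6 * (ind b u * ind c u * ind d u) * Lnum ι - kappa (pull4 u b) (pull4 u c) (pull4 u d)
      - ind b u * (S1 (pull4 u c ∩ pull4 u d) - latinPairs (pull4 u c) (pull4 u d))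
      - ind c u * (S1 (pull4 u b ∩ pull4 u d) - latinPairs (pull4 u b) (pull4 u d))
      - ind d u * (S1 (pull4 u b ∩ pull4 u c) - latinPairs (pull4 u b) (pull4 u c))
      - 2 * (ind b u * ind c u * S1 (pull4 u d) + ind b u * ind d u * S1 (pull4 u c) + ind c u * ind d u * S1 (pull4 u b)) := by
  rw [Phi4_eq_functionals, kappa_eq_functionals]; ring

/-! ## Lemma A₄ and Lemma R₄ -/

/-- **LEMMA A₄** (all `d`, given FBP(3,d)).  For up-sets `b, c, d` of `[4]^ι` and a point `u ∉ b ∩ c ∩ d`, `Φ⁴_{bcd}(u) ≤ 0`. [this work] -/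
theorem Phi4_nonpos (hpos : LatinPos ι) {b c d : Finset (Pt4 ι)} (hb : IsUpperSet (b : Set (Pt4 ι)))
    (hc : IsUpperSet (c : Set (Pt4 ι))) (hd : IsUpperSet (d : Set (Pt4 ι))) {u : Pt4 ι} (hu : ¬ (u ∈ b ∧ u ∈ c ∧ u ∈ d)) :
    Phi4 b c d u ≤ 0 := by
  have hk : 0 ≤ kappa (pull4 u b) (pull4 u c) (pull4 u d) :=
    hpos _ _ _ ⟨isUpperSet_pull4 u hb, isUpperSet_pull4 u hc, isUpperSet_pull4 u hd⟩
  have h1 := latinPairs_le_S1_inter (isUpperSet_pull4 u hc) (isUpperSet_pull4 u hd)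
  have h2 := latinPairs_le_S1_inter (isUpperSet_pull4 u hb) (isUpperSet_pull4 u hd)
  have h3 := latinPairs_le_S1_inter (isUpperSet_pull4 u hb) (isUpperSet_pull4 u hc)
  have s1 := S1_nonneg (pull4 u b)
  have s2 := S1_nonneg (pull4 u c)
  have s3 := S1_nonneg (pull4 u d)
  rw [Phi4_eq_kappa]
  by_cases hbu : u ∈ b
  · rw [ind_of_mem hbu]
    by_cases hcu : u ∈ c
    · rw [ind_of_mem hcu]
      have hdu : u ∉ d := fun h => hu ⟨hbu, hcu, h⟩
      rw [ind_of_not_mem hdu]; linarith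
    · rw [ind_of_not_mem hcu]
      by_cases hdu : u ∈ d
      · rw [ind_of_mem hdu]; linarith
      · rw [ind_of_not_mem hdu]; linarith
  · rw [ind_of_not_mem hbu]
    by_cases hcu : u ∈ c
    · rw [ind_of_mem hcu]
      by_cases hdu : u ∈ d
      · rw [ind_of_mem hdu]; linarith
      · rw [ind_of_not_mem hdu]; linarith
    · rw [ind_of_not_mem hcu]
      by_cases hdu : u ∈ d
      · rw [ind_of_mem hdu]; linarith
      · rw [ind_of_not_mem hdu]; linarith

/-- **LEMMA R₄** (all `d`, no hypotheses on the sets).  A point of `b ∩ c ∩ d` has nonnegative order-4 charge: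
`Φ⁴_{bcd}(u) ≥ 2(L − S(b'c'd')) + E₁ ≥ 0`. [this work] -/
theorem Phi4_nonneg {b c d : Finset (Pt4 ι)} {u : Pt4 ι} (hb : u ∈ b) (hc : u ∈ c) (hd : u ∈ d) : 0 ≤ Phi4 b c d u := by
  rw [Phi4_eq_functionals, ind_of_mem hb, ind_of_mem hc, ind_of_mem hd]
  have e1 := E1_nonneg (pull4 u b) (pull4 u c) (pull4 u d)
  have bo1 := S1_add_S1_le (pull4 u b ∩ pull4 u c) (pull4 u d)
  have bo2 := S1_add_S1_le (pull4 u b ∩ pull4 u d) (pull4 u c)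
  have bo3 := S1_add_S1_le (pull4 u c ∩ pull4 u d) (pull4 u b)
  have hl := S1_le_L (pull4 u b ∩ pull4 u c ∩ pull4 u d)
  linarith

/-! ## The signed single-point moves of `K₄` -/

/-- R-move in the first slot: removing from `a` a point of `b ∩ c ∩ d` does not increase `K₄`. [this work] -/
theorem kappa4_erase_le {a b c d : Finset (Pt4 ι)} {m : Pt4 ι} (hma : m ∈ a) (hmb : m ∈ b) (hmc : m ∈ c) (hmd : m ∈ d) :
    kappa4 (a.erase m) b c d ≤ kappa4 a b c d := by
  rw [kappa4_eq_kappa4_erase_add hma]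
  have := Phi4_nonneg hmb hmc hmd
  linarith

/-- A-move in the first slot (given FBP(3,d)): for up-sets `b, c, d`, adding to `a` a point outside `b ∩ c ∩ d` does not increase
`K₄`. [this work] -/
theorem kappa4_insert_le (hpos : LatinPos ι) {a b c d : Finset (Pt4 ι)} (hb : IsUpperSet (b : Set (Pt4 ι)))
    (hc : IsUpperSet (c : Set (Pt4 ι))) (hd : IsUpperSet (d : Set (Pt4 ι))) {m : Pt4 ι} (hma : m ∉ a)
    (hm : ¬ (m ∈ b ∧ m ∈ c ∧ m ∈ d)) : kappa4 (insert m a) b c d ≤ kappa4 a b c d := by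
  rw [kappa4_insert hma]
  have := Phi4_nonpos hpos hb hc hd hm
  linarith

/-- R-move in the second slot. [this work] -/
theorem kappa4_erase_le₂ {a b c d : Finset (Pt4 ι)} {m : Pt4 ι} (hmb : m ∈ b) (hma : m ∈ a) (hmc : m ∈ c) (hmd : m ∈ d) :
    kappa4 a (b.erase m) c d ≤ kappa4 a b c d := by
  rw [kappa4_swap12 a (b.erase m), kappa4_swap12 a b]
  exact kappa4_erase_le hmb hma hmc hmd

/-- R-move in the third slot. [this work] -/
theorem kappa4_erase_le₃ {a b c d : Finset (Pt4 ι)} {m : Pt4 ι} (hmc : m ∈ c) (hma : m ∈ a) (hmb : m ∈ b) (hmd : m ∈ d) :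
    kappa4 a b (c.erase m) d ≤ kappa4 a b c d := by
  rw [kappa4_swap13 a b (c.erase m), kappa4_swap13 a b c]
  exact kappa4_erase_le hmc hmb hma hmd

/-- R-move in the fourth slot. [this work] -/
theorem kappa4_erase_le₄ {a b c d : Finset (Pt4 ι)} {m : Pt4 ι} (hmd : m ∈ d) (hma : m ∈ a) (hmb : m ∈ b) (hmc : m ∈ c) :
    kappa4 a b c (d.erase m) ≤ kappa4 a b c d := by
  rw [kappa4_swap14 a b c (d.erase m), kappa4_swap14 a b c d]
  exact kappa4_erase_le hmd hmb hmc hma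

/-- A-move in the second slot. [this work] -/
theorem kappa4_insert_le₂ (hpos : LatinPos ι) {a b c d : Finset (Pt4 ι)} (ha : IsUpperSet (a : Set (Pt4 ι)))
    (hc : IsUpperSet (c : Set (Pt4 ι))) (hd : IsUpperSet (d : Set (Pt4 ι))) {m : Pt4 ι} (hmb : m ∉ b)
    (hm : ¬ (m ∈ a ∧ m ∈ c ∧ m ∈ d)) : kappa4 a (insert m b) c d ≤ kappa4 a b c d := by
  rw [kappa4_swap12 a (insert m b), kappa4_swap12 a b]
  exact kappa4_insert_le hpos ha hc hd hmb hm

/-- A-move in the third slot. [this work] -/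
theorem kappa4_insert_le₃ (hpos : LatinPos ι) {a b c d : Finset (Pt4 ι)} (ha : IsUpperSet (a : Set (Pt4 ι)))
    (hb : IsUpperSet (b : Set (Pt4 ι))) (hd : IsUpperSet (d : Set (Pt4 ι))) {m : Pt4 ι} (hmc : m ∉ c)
    (hm : ¬ (m ∈ a ∧ m ∈ b ∧ m ∈ d)) : kappa4 a b (insert m c) d ≤ kappa4 a b c d := by
  rw [kappa4_swap13 a b (insert m c), kappa4_swap13 a b c]
  exact kappa4_insert_le hpos hb ha hd hmc fun h => hm ⟨h.2.1, h.1, h.2.2⟩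

/-- A-move in the fourth slot. [this work] -/
theorem kappa4_insert_le₄ (hpos : LatinPos ι) {a b c d : Finset (Pt4 ι)} (ha : IsUpperSet (a : Set (Pt4 ι)))
    (hb : IsUpperSet (b : Set (Pt4 ι))) (hc : IsUpperSet (c : Set (Pt4 ι))) {m : Pt4 ι} (hmd : m ∉ d)
    (hm : ¬ (m ∈ a ∧ m ∈ b ∧ m ∈ c)) : kappa4 a b c (insert m d) ≤ kappa4 a b c d := by
  rw [kappa4_swap14 a b c (insert m d), kappa4_swap14 a b c d]
  exact kappa4_insert_le hpos hb hc ha hmd fun h => hm ⟨h.2.2, h.1, h.2.1⟩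

/-! ## Up-set bookkeeping on `[4]^ι` -/

omit [DecidableEq ι] in
/-- Removing a MINIMAL element of an up-set of `[4]^ι` leaves an up-set. [this work] -/
theorem isUpperSet_erase_of_minimal₄ {a : Finset (Pt4 ι)} (ha : IsUpperSet (a : Set (Pt4 ι))) {m : Pt4 ι}
    (hmin : ∀ y ∈ a, y ≤ m → y = m) : IsUpperSet ((a.erase m : Finset (Pt4 ι)) : Set (Pt4 ι)) := by
  intro x y hxy hx
  rw [Finset.mem_coe, mem_erase] at hx ⊢
  refine ⟨fun hym => ?_, ha hxy hx.2⟩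
  subst hym
  exact hx.1 (hmin x hx.2 hxy)

omit [DecidableEq ι] in
/-- Adding a MAXIMAL non-element to an up-set of `[4]^ι` leaves an up-set. [this work] -/
theorem isUpperSet_insert_of_maximal₄ {a : Finset (Pt4 ι)} (ha : IsUpperSet (a : Set (Pt4 ι))) {m : Pt4 ι}
    (hmax : ∀ y, m ≤ y → y ≠ m → y ∈ a) : IsUpperSet ((insert m a : Finset (Pt4 ι)) : Set (Pt4 ι)) := by
  intro x y hxy hx
  rw [Finset.mem_coe, mem_insert] at hx ⊢
  rcases hx with rfl | hx
  · by_cases h : y = x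
    · exact Or.inl h
    · exact Or.inr (hmax y hxy h)
  · exact Or.inr (ha hxy hx)

end Summit.CriticalPhenomena.PercolationContinuityZ3.Theorems.SahiLatin
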